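import Summits.QuantumFields.YangMills.Theorems.SwapVirialDeficitBlowUpGnomonicTrFibreRescaled
import Summits.QuantumFields.YangMills.Theorems.SwapVirialDeficitGnomonicTaylorHubLineTr
import Summits.QuantumFields.YangMills.Theorems.SwapVirialDeficitBlowUpGnomonicBFibreJets
import HarnessLib

/-!
# STUB (S-001-good) OF SKELETON ➎: JETS OF THE 001 FIBRES IN THE E1-RESCALED CHART — smoothness, `u`-UNIFORM line jets (K7g), third-derivative bound, flat and
# critical base (free-hands support of ⟨stmt-QuantumFields-24197⟩ `SwapVirialDeficit.SwapGluedStiffness`; cell ym-idea-1; twin of w2 g59's ✓`…BFibreJets` ∕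
# ✓`…BFibreRescaledCubic` for the 001 chart ✓`gnoFibreTrEquiv (u, gnoScaleTr u y)`; assembler fcl-p3 g48)

`F₁(δ, η) := trGnoDeficit uJ z₁ (sectorChar z₁) (hubAt δ 1) ε η` on `ℝ × GnoCoord L`; the rescaled 001 chart `Ψ(u, y) = gnoFibreTrEquiv (u, gnoScaleTr u y)
= gnoBaseTr u + gnoFibreTrEmb u₂ (gnoScaleTr u y)` is AFFINE along each fibre.  Along a fibre ray the `x`-letter moves orthogonally to the flat unit direction
`f_x(u₂) = rotX(−arctan u₂)(0,1,0)` with `f_x`-component `u₁` and speed `√(1+u₁²)·|w_x|`, the `y`-letter orthogonally to `f_y = (1,0,0)` with axial component `u₂`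
and speed `√(1+u₂²)·|w_y⊥|`, so K7g (✓`taylor_four_trGnoDeficit_hubLine_perp`) gives `u`-UNIFORM jets of size `‖w‖`:
* §1 `contDiff_trDeficit` (`(δ,η) ↦ F₁` is `C^n`, g47's ✓`contDiff_trGnoDeficit_hubShift`), `contDiff_trFibre (θ p)` (`y ↦ F₁(p + gnoFibreTrEmb θ y)`), rays
  `trFibre_ray`, `trDeficit_ray_eq_hubLine`, `trDeficit_add_eq_hubShift`, `trFibre_rescaled_eq` (`F₁(Ψ(u,y)) = F₁(gnoBaseTr u + gnoFibreTrEmb u₂ (gnoScaleTr u y))`);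
* §2 letter bookkeeping: `sum_mul_rotX` (rotations preserve `Σaᵢbᵢ`), `letterSq_gnoFibreB_blocks` ∕ `letterSizes_trScaled` (the five letter sizes of the rescaled direction,
  the two perpendicularity identities and the two base components `u₁`, `u₂`);
* §3 ★★ `trFibre_rescaled_lineJets (u z₀ w)` — K7d's constants `1008L⁴‖w‖, 39984L⁴‖w‖², 6816096L⁴‖w‖³, 1464571584L⁴‖w‖⁴` for `s ↦ F₁(Ψ(u, z₀ + s·w))`, EVERY base `u`,
  EVERY fibre point `z₀` (no `|u|`-dependence — the point of K7g); ★ `trFibre_rescaled_third_bound`, ★ `trFibre_rescaled_second_bound`;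
* §4 the base: `trFibre_rescaled_base_apply_zero` (✓`trGnoDeficit_gnoBaseTr_eq_zero`), ★ `fderiv_trFibre_rescaled_base_eq_zero` (minimum ⟹ critical).

HONEST LABEL: calculus bookkeeping; the Hessian family ∕ coercivity ∕ sockets (next file), the 001 law, `stub_h001_good`, (S-core-tip), (S-core-end), ⟨24197⟩ ∕ ⟨24194⟩ OPEN;
item of record ⟨24085⟩ SubOctaveBounded aside ∕ untouched; the Yang–Mills mass gap is NOT proved; no summit is proved by a line.  THEOREMS ONLY (0 `def`, 0 `sorry`),
standard axioms, no instances.  Seat ym-line-fcl-p3 g48 (cell ym-idea-1, free hands), `--supports stmt-QuantumFields-24197`.  References: [cite: Luscher1983, §2]; [folklore].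
-/

set_option autoImplicit false
set_option synthInstance.maxSize 1024

noncomputable section

open MeasureTheory Quaternion Set Metric
open scoped BigOperators Quaternion InnerProductSpace ENNReal
open Literature.MathematicalPhysics.QuantumFieldTheory hiding SU2
open Literature.MathematicalPhysics.QuantumLattice

namespace Summit.QuantumFields.YangMills.Theorems.SwapVirialDeficit.BlowUpRing

open Summit.QuantumFields.YangMills.Theorems.FemtoTransferGap
open Summit.QuantumFields.YangMills.Theorems.FemtoTransferGap.TT
open Summit.QuantumFields.YangMills.Theorems.VirialFluxGap.RingDeficit
open Summit.QuantumFields.YangMills.Theorems.SwapVirialDeficit.SwapRing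
open Summit.QuantumFields.YangMills.Theorems.SwapVirialDeficit.Gnomonic (normSq3 normSq3_nonneg taylor_four_trGnoDeficit_hubLine_perp contDiff_trGnoDeficit_hubShift)
open Summit.QuantumFields.YangMills.Theorems.QuantitativeLaplace (third_bound_of_lineJet iteratedFDeriv_two_eq_lineJet)
open Summit.QuantumFields.YangMills.Theorems.SwapVirialDeficit.SectorLaplace (z₁ uJ sectorChar norm_uJ)

variable {L : ℕ} [NeZero L]

/-! ## §1 Smoothness and rays -/

/-- ★ `(δ, η) ↦ F₁(δ, η) = trGnoDeficit uJ z₁ (sectorChar z₁) (hubAt δ 1) ε η` is `C^n` on `ℝ × GnoCoord L` (g47's ✓`contDiff_trGnoDeficit_hubShift` at `hubAt 0 1`,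
composed with `δ ↦ −δ`). [cite: Luscher1983, §2] -/
theorem contDiff_trDeficit (ε : GnoSign L) {n : ℕ∞} :
    ContDiff ℝ n fun p : ℝ × GnoCoord L => trGnoDeficit uJ z₁ (sectorChar z₁) (hubAt p.1 1) ε p.2 := by
  have hc := contDiff_trGnoDeficit_hubShift (n := n) norm_uJ z₁ (sectorChar (L := L) z₁) hubAt_zero_one_im_ne_zero ε
  have e : (fun p : ℝ × GnoCoord L => trGnoDeficit uJ z₁ (sectorChar z₁) (hubAt p.1 1) ε p.2) =
      (fun p : ℝ × GnoCoord L => trGnoDeficit uJ z₁ (sectorChar z₁) (hubAt 0 1 - p.1 • (1 : ℍ)) ε p.2) ∘ fun p : ℝ × GnoCoord L => (-p.1, p.2) := by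
    funext p; simp only [Function.comp_apply, hubAt_eq_equator_sub_smul p.1]
  rw [e]
  exact hc.comp (contDiff_fst.neg.prodMk contDiff_snd)

/-- `y ↦ F₁(p + gnoFibreTrEmb θ y)` is `C^n` for every expansion point `p` and angle parameter `θ`. [cite: Luscher1983, §2] -/
theorem contDiff_trFibre (ε : GnoSign L) (θ : ℝ) (p : ℝ × GnoCoord L) {n : ℕ∞} :
    ContDiff ℝ n fun y : GnoFibreB L => trGnoDeficit uJ z₁ (sectorChar z₁) (hubAt (p + gnoFibreTrEmb θ y).1 1) ε (p + gnoFibreTrEmb θ y).2 :=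
  (contDiff_trDeficit (n := n) ε).comp (contDiff_const.add (gnoFibreTrEmb (L := L) θ).contDiff)

/-- The rescaling `gnoScaleTr u` is `C^∞` (a linear map of a finite-dimensional space). [folklore] -/
theorem contDiff_gnoScaleTr (u : ℝ × ℝ) {n : ℕ∞} : ContDiff ℝ n (gnoScaleTr (L := L) u) := by
  have h := (LinearMap.toContinuousLinearMap (gnoScaleTrLin (L := L) u)).contDiff (n := n)
  have e : ⇑(LinearMap.toContinuousLinearMap (gnoScaleTrLin (L := L) u)) = gnoScaleTr u := by
    rw [LinearMap.coe_toContinuousLinearMap']; rfl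
  rw [e] at h
  exact h

/-- ★ The rescaled 001 fibre restriction in affine form: `F₁(Ψ(u,y)) = F₁(gnoBaseTr u + gnoFibreTrEmb u₂ (gnoScaleTr u y))`. [folklore] -/
theorem trFibre_rescaled_eq (ε : GnoSign L) (u : ℝ × ℝ) (y : GnoFibreB L) :
    trGnoDeficit uJ z₁ (sectorChar z₁) (hubAt (gnoFibreTrEquiv (u, gnoScaleTr u y)).1 1) ε (gnoFibreTrEquiv (u, gnoScaleTr u y)).2 =
      trGnoDeficit uJ z₁ (sectorChar z₁) (hubAt (gnoBaseTr u + gnoFibreTrEmb u.2 (gnoScaleTr u y)).1 1) ε (gnoBaseTr u + gnoFibreTrEmb u.2 (gnoScaleTr u y)).2 := by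
  rw [gnoFibreTrEquiv_apply]

/-- `y ↦ F₁(Ψ(u, y))` is `C^n`. [cite: Luscher1983, §2] -/
theorem contDiff_trFibre_rescaled (ε : GnoSign L) (u : ℝ × ℝ) {n : ℕ∞} :
    ContDiff ℝ n fun y : GnoFibreB L => trGnoDeficit uJ z₁ (sectorChar z₁) (hubAt (gnoFibreTrEquiv (u, gnoScaleTr u y)).1 1) ε (gnoFibreTrEquiv (u, gnoScaleTr u y)).2 := by
  have e : (fun y : GnoFibreB L => trGnoDeficit uJ z₁ (sectorChar z₁) (hubAt (gnoFibreTrEquiv (u, gnoScaleTr u y)).1 1) ε (gnoFibreTrEquiv (u, gnoScaleTr u y)).2) =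
      (fun y : GnoFibreB L => trGnoDeficit uJ z₁ (sectorChar z₁) (hubAt (gnoBaseTr u + gnoFibreTrEmb u.2 y).1 1) ε (gnoBaseTr u + gnoFibreTrEmb u.2 y).2) ∘
        gnoScaleTr u := by
    funext y; simp only [Function.comp_apply, trFibre_rescaled_eq]
  rw [e]
  exact (contDiff_trFibre (n := n) ε u.2 (gnoBaseTr u)).comp (contDiff_gnoScaleTr u)

/-- Rays of the rescaled fibre restriction: `F₁(Ψ(u, z₀ + s·w)) = F₁(Ψ(u, z₀) + s·gnoFibreTrEmb u₂ (gnoScaleTr u w))`. [folklore] -/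
theorem trFibre_rescaled_ray (ε : GnoSign L) (u : ℝ × ℝ) (z₀ w : GnoFibreB L) :
    (fun s : ℝ => trGnoDeficit uJ z₁ (sectorChar z₁) (hubAt (gnoFibreTrEquiv (u, gnoScaleTr u (z₀ + s • w))).1 1) ε (gnoFibreTrEquiv (u, gnoScaleTr u (z₀ + s • w))).2) =
      fun s : ℝ => trGnoDeficit uJ z₁ (sectorChar z₁) (hubAt ((gnoFibreTrEquiv (u, gnoScaleTr u z₀)) + s • gnoFibreTrEmb u.2 (gnoScaleTr u w)).1 1) ε
        ((gnoFibreTrEquiv (u, gnoScaleTr u z₀)) + s • gnoFibreTrEmb u.2 (gnoScaleTr u w)).2 := by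
  funext s
  have e : gnoFibreTrEquiv (u, gnoScaleTr u (z₀ + s • w)) = gnoFibreTrEquiv (u, gnoScaleTr u z₀) + s • gnoFibreTrEmb u.2 (gnoScaleTr u w) := by
    rw [gnoFibreTrEquiv_apply, gnoFibreTrEquiv_apply, ← gnoScaleTrLin_apply, ← gnoScaleTrLin_apply, ← gnoScaleTrLin_apply, map_add, map_smul, map_add, map_smul,
      add_assoc]
  rw [e]

/-- A 001-ray IS one of K7g's joint hub–letter lines: `F₁(p + s·E) = trGnoDeficit uJ z₁ χ₁ (hubAt p.1 1 − (s·(−E.1))·1) ε (p.2 + s·E.2)`. [folklore] -/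
theorem trDeficit_ray_eq_hubLine (ε : GnoSign L) (p E : ℝ × GnoCoord L) :
    (fun s : ℝ => trGnoDeficit uJ z₁ (sectorChar z₁) (hubAt (p + s • E).1 1) ε (p + s • E).2) =
      fun s : ℝ => trGnoDeficit uJ z₁ (sectorChar z₁) (hubAt p.1 1 - (s * -E.1) • (1 : ℍ)) ε (p.2 + s • E.2) := by
  funext s
  rw [Prod.fst_add, Prod.snd_add, Prod.smul_fst, Prod.smul_snd, smul_eq_mul, hubAt_add_one_eq_sub_smul, mul_neg]

/-- The end point of a 001-ray in K7g's letters. [folklore] -/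
theorem trDeficit_add_eq_hubShift (ε : GnoSign L) (p E : ℝ × GnoCoord L) :
    trGnoDeficit uJ z₁ (sectorChar z₁) (hubAt (p + E).1 1) ε (p + E).2 = trGnoDeficit uJ z₁ (sectorChar z₁) (hubAt p.1 1 - (-E.1) • (1 : ℍ)) ε (p.2 + E.2) := by
  rw [Prod.fst_add, Prod.snd_add, hubAt_add_one_eq_sub_smul]

/-! ## §2 Letter bookkeeping of the rescaled direction -/

omit [NeZero L] in
/-- Rotations of the transverse plane preserve `Σᵢ aᵢbᵢ`. [folklore] -/
theorem sum_mul_rotX (θ : ℝ) (a b : Fin 3 → ℝ) : ∑ i, rotX θ a i * rotX θ b i = ∑ i, a i * b i := by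
  have hcs : Real.cos θ ^ 2 + Real.sin θ ^ 2 = 1 := Real.cos_sq_add_sin_sq θ
  simp only [rotX, Fin.sum_univ_three, Matrix.cons_val_zero, Matrix.cons_val_one, Matrix.cons_val_two, Matrix.head_cons, Matrix.tail_cons]
  linear_combination (a 1 * b 1 + a 2 * b 2) * hcs

/-- The letter blocks of a B-fibre vector have size-squares `≤ ‖y‖²`: `y_{t0}²`, `y_{t1}² + y_{t2}²`, `y_{v0}² + y_{v1}²`, `Σ_k y_{z,k}²`, `Σ_k y_{F,f,k}²`. [folklore] -/
theorem letterSq_gnoFibreB_blocks (y : GnoFibreB L) :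
    y (Sum.inl (Sum.inl 0)) ^ 2 ≤ ‖y‖ ^ 2 ∧ y (Sum.inl (Sum.inl 1)) ^ 2 + y (Sum.inl (Sum.inl 2)) ^ 2 ≤ ‖y‖ ^ 2 ∧
      y (Sum.inl (Sum.inr 0)) ^ 2 + y (Sum.inl (Sum.inr 1)) ^ 2 ≤ ‖y‖ ^ 2 ∧ normSq3 (fun k => y (Sum.inr (Sum.inl k))) ≤ ‖y‖ ^ 2 ∧
      ∀ i, normSq3 (fun k => y (Sum.inr (Sum.inr (i, k)))) ≤ ‖y‖ ^ 2 := by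
  have hN := norm_sq_gnoFibreB_letters y
  have h0 : 0 ≤ y (Sum.inl (Sum.inl 0)) ^ 2 := sq_nonneg _
  have h1 : 0 ≤ y (Sum.inl (Sum.inl 1)) ^ 2 := sq_nonneg _
  have h2 : 0 ≤ y (Sum.inl (Sum.inl 2)) ^ 2 := sq_nonneg _
  have h3 : 0 ≤ y (Sum.inl (Sum.inr 0)) ^ 2 := sq_nonneg _
  have h4 : 0 ≤ y (Sum.inl (Sum.inr 1)) ^ 2 := sq_nonneg _
  have h5 : 0 ≤ normSq3 (fun k => y (Sum.inr (Sum.inl k))) := normSq3_nonneg _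
  have h6 : 0 ≤ ∑ f, normSq3 (fun k => y (Sum.inr (Sum.inr (f, k)))) := Finset.sum_nonneg fun f _ => normSq3_nonneg _
  refine ⟨by linarith, by linarith, by linarith, by linarith, fun i => ?_⟩
  have hi : normSq3 (fun k => y (Sum.inr (Sum.inr (i, k)))) ≤ ∑ f, normSq3 (fun k => y (Sum.inr (Sum.inr (f, k)))) :=
    Finset.single_le_sum (f := fun f => normSq3 (fun k => y (Sum.inr (Sum.inr (f, k))))) (fun f _ => normSq3_nonneg _) (Finset.mem_univ i)
  linarith

/-- ★ **THE LETTERS OF A RESCALED 001-RAY** from the chart point `P = Ψ(u, z₀)` in the direction `E = gnoFibreTrEmb u₂ (gnoScaleTr u w)`: with the flat unit direction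
`f_x = rotX(−arctan u₂)(0,1,0)` and `f_y = (1,0,0)`: `Σf_x² = 1`, `E_x ⊥ f_x`, `E_y ⊥ f_y`, `⟪P_x, f_x⟫ = u₁`, `⟪P_y, f_y⟫ = u₂`, and the sizes `|E_δ| ≤ ‖w‖`,
`√ΣE_x² ≤ ‖w‖·√(1+u₁²)`, `√ΣE_y² ≤ ‖w‖·√(1+u₂²)`, `√ΣE_z² ≤ ‖w‖`, `√ΣE_{F,f}² ≤ ‖w‖`. [folklore] -/
theorem letterSizes_trScaled (u : ℝ × ℝ) (z₀ w : GnoFibreB L) :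
    (∑ i, rotX (-Real.arctan u.2) (![0, 1, 0] : Fin 3 → ℝ) i ^ 2 = 1) ∧
      (∑ i, (gnoFibreTrEmb u.2 (gnoScaleTr u w)).2.1.1 i * rotX (-Real.arctan u.2) (![0, 1, 0] : Fin 3 → ℝ) i = 0) ∧
      (∑ i, (gnoFibreTrEmb u.2 (gnoScaleTr u w)).2.1.2 i * (![1, 0, 0] : Fin 3 → ℝ) i = 0) ∧
      (∑ i, (gnoFibreTrEquiv (u, gnoScaleTr u z₀)).2.1.1 i * rotX (-Real.arctan u.2) (![0, 1, 0] : Fin 3 → ℝ) i = u.1) ∧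
      (∑ i, (gnoFibreTrEquiv (u, gnoScaleTr u z₀)).2.1.2 i * (![1, 0, 0] : Fin 3 → ℝ) i = u.2) ∧
      |(-(gnoFibreTrEmb u.2 (gnoScaleTr u w)).1)| ≤ ‖w‖ ∧
      Real.sqrt (∑ k, (gnoFibreTrEmb u.2 (gnoScaleTr u w)).2.1.1 k ^ 2) ≤ ‖w‖ * Real.sqrt (1 + u.1 ^ 2) ∧
      Real.sqrt (∑ k, (gnoFibreTrEmb u.2 (gnoScaleTr u w)).2.1.2 k ^ 2) ≤ ‖w‖ * Real.sqrt (1 + u.2 ^ 2) ∧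
      Real.sqrt (∑ k, (gnoFibreTrEmb u.2 (gnoScaleTr u w)).2.2.1 k ^ 2) ≤ ‖w‖ ∧
      ∀ i, Real.sqrt (∑ k, (gnoFibreTrEmb u.2 (gnoScaleTr u w)).2.2.2 i k ^ 2) ≤ ‖w‖ := by
  obtain ⟨h0, hx, hy, hz, hf⟩ := letterSq_gnoFibreB_blocks w
  have hw0 : 0 ≤ ‖w‖ := norm_nonneg _
  have hc1 : 0 ≤ Real.sqrt (1 + u.1 ^ 2) := Real.sqrt_nonneg _
  have hc2 : 0 ≤ Real.sqrt (1 + u.2 ^ 2) := Real.sqrt_nonneg _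
  have hc1sq : Real.sqrt (1 + u.1 ^ 2) ^ 2 = 1 + u.1 ^ 2 := Real.sq_sqrt (by positivity)
  have hc2sq : Real.sqrt (1 + u.2 ^ 2) ^ 2 = 1 + u.2 ^ 2 := Real.sq_sqrt (by positivity)
  rw [gnoFibreTrEmb_gnoScaleTr, gnoFibreTrEquiv_gnoScaleTr]
  refine ⟨?_, ?_, ?_, ?_, ?_, ?_, ?_, ?_, ?_, fun i => ?_⟩
  · rw [sum_sq_rotX]; simp [Fin.sum_univ_three]
  · rw [sum_mul_rotX]; simp [Fin.sum_univ_three]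
  · simp [Fin.sum_univ_three]
  · rw [sum_mul_rotX]; simp [Fin.sum_univ_three]
  · simp [Fin.sum_univ_three]
  · rw [abs_neg]; exact abs_le_of_sq_le_sq' (by rw [show ‖w‖ ^ 2 = ‖w‖ ^ 2 from rfl]; linarith) hw0 |> fun h => abs_le.2 h
  · rw [sum_sq_rotX]
    have e : ∑ i : Fin 3, (![Real.sqrt (1 + u.1 ^ 2) * w (Sum.inl (Sum.inl 1)), 0, Real.sqrt (1 + u.1 ^ 2) * w (Sum.inl (Sum.inl 2))] : Fin 3 → ℝ) i ^ 2 =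
        (1 + u.1 ^ 2) * (w (Sum.inl (Sum.inl 1)) ^ 2 + w (Sum.inl (Sum.inl 2)) ^ 2) := by
      simp only [Fin.sum_univ_three, Matrix.cons_val_zero, Matrix.cons_val_one, Matrix.cons_val_two, Matrix.head_cons, Matrix.tail_cons]
      rw [mul_pow, mul_pow, hc1sq]; ring
    rw [e]
    calc Real.sqrt ((1 + u.1 ^ 2) * (w (Sum.inl (Sum.inl 1)) ^ 2 + w (Sum.inl (Sum.inl 2)) ^ 2)) ≤ Real.sqrt ((1 + u.1 ^ 2) * ‖w‖ ^ 2) :=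
          Real.sqrt_le_sqrt (mul_le_mul_of_nonneg_left hx (by positivity))
      _ = ‖w‖ * Real.sqrt (1 + u.1 ^ 2) := by rw [Real.sqrt_mul (by positivity), Real.sqrt_sq hw0, mul_comm]
  · have e : ∑ i : Fin 3, (![0, Real.sqrt (1 + u.2 ^ 2) * w (Sum.inl (Sum.inr 0)), Real.sqrt (1 + u.2 ^ 2) * w (Sum.inl (Sum.inr 1))] : Fin 3 → ℝ) i ^ 2 =
        (1 + u.2 ^ 2) * (w (Sum.inl (Sum.inr 0)) ^ 2 + w (Sum.inl (Sum.inr 1)) ^ 2) := by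
      simp only [Fin.sum_univ_three, Matrix.cons_val_zero, Matrix.cons_val_one, Matrix.cons_val_two, Matrix.head_cons, Matrix.tail_cons]
      rw [mul_pow, mul_pow, hc2sq]; ring
    rw [e]
    calc Real.sqrt ((1 + u.2 ^ 2) * (w (Sum.inl (Sum.inr 0)) ^ 2 + w (Sum.inl (Sum.inr 1)) ^ 2)) ≤ Real.sqrt ((1 + u.2 ^ 2) * ‖w‖ ^ 2) :=
          Real.sqrt_le_sqrt (mul_le_mul_of_nonneg_left hy (by positivity))
      _ = ‖w‖ * Real.sqrt (1 + u.2 ^ 2) := by rw [Real.sqrt_mul (by positivity), Real.sqrt_sq hw0, mul_comm]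
  · exact (Real.sqrt_le_sqrt hz).trans_eq (Real.sqrt_sq hw0)
  · exact (Real.sqrt_le_sqrt (hf i)).trans_eq (Real.sqrt_sq hw0)

/-! ## §3 `u`-uniform line jets of the rescaled 001 fibres (K7g) -/

/-- ★★ **K7g's LINE JETS ALONG A RESCALED 001-RAY, size `S = ‖w‖` FOR EVERY BASE POINT**: with `P = Ψ(u, z₀)`, `E = gnoFibreTrEmb u₂ (gnoScaleTr u w)` and
`ψ s = F₁(P + s·E)`: `|ψ′| ≤ 1008L⁴‖w‖`, `|ψ″| ≤ 39984L⁴‖w‖²`, `|ψ‴| ≤ 6816096L⁴‖w‖³`, `|ψ⁗| ≤ 1464571584L⁴‖w‖⁴` everywhere, and the order-2 ∕ order-3 Taylor remainders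
at `s = 0` — no `|u|`-dependence (✓`taylor_four_trGnoDeficit_hubLine_perp` with `f_x = rotX(−arctan u₂)(0,1,0)`, `f_y = (1,0,0)`). [cite: Luscher1983, §2] -/
theorem trFibre_rescaled_lineJets (ε : GnoSign L) (u : ℝ × ℝ) (z₀ w : GnoFibreB L) :
    (∀ s, |deriv (fun s : ℝ => trGnoDeficit uJ z₁ (sectorChar z₁) (hubAt ((gnoFibreTrEquiv (u, gnoScaleTr u z₀)) + s • gnoFibreTrEmb u.2 (gnoScaleTr u w)).1 1) ε
          ((gnoFibreTrEquiv (u, gnoScaleTr u z₀)) + s • gnoFibreTrEmb u.2 (gnoScaleTr u w)).2) s| ≤ 1008 * (L : ℝ) ^ 4 * ‖w‖ ∧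
        |iteratedDeriv 2 (fun s : ℝ => trGnoDeficit uJ z₁ (sectorChar z₁) (hubAt ((gnoFibreTrEquiv (u, gnoScaleTr u z₀)) + s • gnoFibreTrEmb u.2 (gnoScaleTr u w)).1 1) ε
          ((gnoFibreTrEquiv (u, gnoScaleTr u z₀)) + s • gnoFibreTrEmb u.2 (gnoScaleTr u w)).2) s| ≤ 39984 * (L : ℝ) ^ 4 * ‖w‖ ^ 2 ∧
        |iteratedDeriv 3 (fun s : ℝ => trGnoDeficit uJ z₁ (sectorChar z₁) (hubAt ((gnoFibreTrEquiv (u, gnoScaleTr u z₀)) + s • gnoFibreTrEmb u.2 (gnoScaleTr u w)).1 1) ε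
          ((gnoFibreTrEquiv (u, gnoScaleTr u z₀)) + s • gnoFibreTrEmb u.2 (gnoScaleTr u w)).2) s| ≤ 6816096 * (L : ℝ) ^ 4 * ‖w‖ ^ 3 ∧
        |iteratedDeriv 4 (fun s : ℝ => trGnoDeficit uJ z₁ (sectorChar z₁) (hubAt ((gnoFibreTrEquiv (u, gnoScaleTr u z₀)) + s • gnoFibreTrEmb u.2 (gnoScaleTr u w)).1 1) ε
          ((gnoFibreTrEquiv (u, gnoScaleTr u z₀)) + s • gnoFibreTrEmb u.2 (gnoScaleTr u w)).2) s| ≤ 1464571584 * (L : ℝ) ^ 4 * ‖w‖ ^ 4) ∧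
      |trGnoDeficit uJ z₁ (sectorChar z₁) (hubAt ((gnoFibreTrEquiv (u, gnoScaleTr u z₀)) + gnoFibreTrEmb u.2 (gnoScaleTr u w)).1 1) ε
            ((gnoFibreTrEquiv (u, gnoScaleTr u z₀)) + gnoFibreTrEmb u.2 (gnoScaleTr u w)).2 -
          trGnoDeficit uJ z₁ (sectorChar z₁) (hubAt (gnoFibreTrEquiv (u, gnoScaleTr u z₀)).1 1) ε (gnoFibreTrEquiv (u, gnoScaleTr u z₀)).2 -
          deriv (fun s : ℝ => trGnoDeficit uJ z₁ (sectorChar z₁) (hubAt ((gnoFibreTrEquiv (u, gnoScaleTr u z₀)) + s • gnoFibreTrEmb u.2 (gnoScaleTr u w)).1 1) ε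
            ((gnoFibreTrEquiv (u, gnoScaleTr u z₀)) + s • gnoFibreTrEmb u.2 (gnoScaleTr u w)).2) 0 -
          iteratedDeriv 2 (fun s : ℝ => trGnoDeficit uJ z₁ (sectorChar z₁) (hubAt ((gnoFibreTrEquiv (u, gnoScaleTr u z₀)) + s • gnoFibreTrEmb u.2 (gnoScaleTr u w)).1 1) ε
            ((gnoFibreTrEquiv (u, gnoScaleTr u z₀)) + s • gnoFibreTrEmb u.2 (gnoScaleTr u w)).2) 0 / 2| ≤ 6816096 * (L : ℝ) ^ 4 * ‖w‖ ^ 3 / 2 ∧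
      |trGnoDeficit uJ z₁ (sectorChar z₁) (hubAt ((gnoFibreTrEquiv (u, gnoScaleTr u z₀)) + gnoFibreTrEmb u.2 (gnoScaleTr u w)).1 1) ε
            ((gnoFibreTrEquiv (u, gnoScaleTr u z₀)) + gnoFibreTrEmb u.2 (gnoScaleTr u w)).2 -
          trGnoDeficit uJ z₁ (sectorChar z₁) (hubAt (gnoFibreTrEquiv (u, gnoScaleTr u z₀)).1 1) ε (gnoFibreTrEquiv (u, gnoScaleTr u z₀)).2 -
          deriv (fun s : ℝ => trGnoDeficit uJ z₁ (sectorChar z₁) (hubAt ((gnoFibreTrEquiv (u, gnoScaleTr u z₀)) + s • gnoFibreTrEmb u.2 (gnoScaleTr u w)).1 1) ε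
            ((gnoFibreTrEquiv (u, gnoScaleTr u z₀)) + s • gnoFibreTrEmb u.2 (gnoScaleTr u w)).2) 0 -
          iteratedDeriv 2 (fun s : ℝ => trGnoDeficit uJ z₁ (sectorChar z₁) (hubAt ((gnoFibreTrEquiv (u, gnoScaleTr u z₀)) + s • gnoFibreTrEmb u.2 (gnoScaleTr u w)).1 1) ε
            ((gnoFibreTrEquiv (u, gnoScaleTr u z₀)) + s • gnoFibreTrEmb u.2 (gnoScaleTr u w)).2) 0 / 2 -
          iteratedDeriv 3 (fun s : ℝ => trGnoDeficit uJ z₁ (sectorChar z₁) (hubAt ((gnoFibreTrEquiv (u, gnoScaleTr u z₀)) + s • gnoFibreTrEmb u.2 (gnoScaleTr u w)).1 1) ε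
            ((gnoFibreTrEquiv (u, gnoScaleTr u z₀)) + s • gnoFibreTrEmb u.2 (gnoScaleTr u w)).2) 0 / 6| ≤ 1464571584 * (L : ℝ) ^ 4 * ‖w‖ ^ 4 / 6 := by
  obtain ⟨hfx, hξx, hξy, hPx, hPy, hδ, hx, hy, hz, hf⟩ := letterSizes_trScaled (L := L) u z₀ w
  have hδ' : |(-(gnoFibreTrEmb u.2 (gnoScaleTr u w)).1)| ≤ ‖w‖ * ‖(hubAt (gnoFibreTrEquiv (u, gnoScaleTr u z₀)).1 1).im‖ := by
    rw [norm_im_hubAt_one, mul_one]; exact hδ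
  have hx' : Real.sqrt (∑ k, (gnoFibreTrEmb u.2 (gnoScaleTr u w)).2.1.1 k ^ 2) ≤
      ‖w‖ * Real.sqrt (1 + (∑ i, (gnoFibreTrEquiv (u, gnoScaleTr u z₀)).2.1.1 i * rotX (-Real.arctan u.2) (![0, 1, 0] : Fin 3 → ℝ) i) ^ 2) := by
    rw [hPx]; exact hx
  have hy' : Real.sqrt (∑ k, (gnoFibreTrEmb u.2 (gnoScaleTr u w)).2.1.2 k ^ 2) ≤
      ‖w‖ * Real.sqrt (1 + (∑ i, (gnoFibreTrEquiv (u, gnoScaleTr u z₀)).2.1.2 i * (![1, 0, 0] : Fin 3 → ℝ) i) ^ 2) := by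
    rw [hPy]; exact hy
  have hfy : ∑ i, (![1, 0, 0] : Fin 3 → ℝ) i ^ 2 = 1 := by simp [Fin.sum_univ_three]
  have h := taylor_four_trGnoDeficit_hubLine_perp norm_uJ z₁ (sectorChar (L := L) z₁) (hubAt_one_im_ne_zero (gnoFibreTrEquiv (u, gnoScaleTr u z₀)).1)
    (-(gnoFibreTrEmb u.2 (gnoScaleTr u w)).1) ε (gnoFibreTrEquiv (u, gnoScaleTr u z₀)).2 (gnoFibreTrEmb u.2 (gnoScaleTr u w)).2
    (rotX (-Real.arctan u.2) (![0, 1, 0] : Fin 3 → ℝ)) (![1, 0, 0] : Fin 3 → ℝ) hfx hfy hξx hξy (norm_nonneg w) hδ' hx' hy' hz hf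
  rw [trDeficit_ray_eq_hubLine, trDeficit_add_eq_hubShift]
  exact h

/-- ★ **THE DIRECTIONAL THIRD DERIVATIVE ON THE WHOLE RESCALED 001 FIBRE**: `|D³_y (F₁∘Ψ(u,·))(z₀)[w,w,w]| ≤ 6816096L⁴‖w‖³` at EVERY fibre point `z₀`, EVERY base `u`
(✓`third_bound_of_lineJet`; the `A₃` of ✓`cubicDatum_of_third`). [cite: Luscher1983, §2] -/
theorem trFibre_rescaled_third_bound (ε : GnoSign L) (u : ℝ × ℝ) (z₀ w : GnoFibreB L) :
    |iteratedFDeriv ℝ 3 (fun y : GnoFibreB L =>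
        trGnoDeficit uJ z₁ (sectorChar z₁) (hubAt (gnoFibreTrEquiv (u, gnoScaleTr u y)).1 1) ε (gnoFibreTrEquiv (u, gnoScaleTr u y)).2) z₀ (fun _ => w)| ≤
      6816096 * (L : ℝ) ^ 4 * ‖w‖ ^ 3 := by
  refine third_bound_of_lineJet (S := univ) (contDiff_trFibre_rescaled (n := 3) ε u) (fun z₁' _ ξ => ?_) z₀ (mem_univ _) w
  rw [trFibre_rescaled_ray]
  exact ((trFibre_rescaled_lineJets ε u z₁' ξ).1 0).2.2.1

/-- ★ **THE DIRECTIONAL SECOND DERIVATIVE ON THE WHOLE RESCALED 001 FIBRE**: `|D²_y (F₁∘Ψ(u,·))(z₀)[w,w]| ≤ 39984L⁴‖w‖²`. [cite: Luscher1983, §2] -/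
theorem trFibre_rescaled_second_bound (ε : GnoSign L) (u : ℝ × ℝ) (z₀ w : GnoFibreB L) :
    |iteratedFDeriv ℝ 2 (fun y : GnoFibreB L =>
        trGnoDeficit uJ z₁ (sectorChar z₁) (hubAt (gnoFibreTrEquiv (u, gnoScaleTr u y)).1 1) ε (gnoFibreTrEquiv (u, gnoScaleTr u y)).2) z₀ (fun _ => w)| ≤
      39984 * (L : ℝ) ^ 4 * ‖w‖ ^ 2 := by
  rw [iteratedFDeriv_two_eq_lineJet (contDiff_trFibre_rescaled (n := 2) ε u) z₀ w, trFibre_rescaled_ray]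
  exact ((trFibre_rescaled_lineJets ε u z₀ w).1 0).2.1

/-! ## §4 The base of the rescaled 001 chart is flat and critical -/

/-- The rescaled 001 chart at the zero fibre vector is the base point. [folklore] -/
theorem gnoFibreTrEquiv_gnoScaleTr_zero (u : ℝ × ℝ) : gnoFibreTrEquiv (u, gnoScaleTr u (0 : GnoFibreB L)) = gnoBaseTr u := by
  rw [gnoScaleTr_zero, gnoFibreTrEquiv_zero]

/-- ★ The rescaled fibre restriction vanishes at the origin of the fibre (good sign patterns): `F₁(Ψ(u, 0)) = 0`. [cite: tHooft1979] -/
theorem trFibre_rescaled_base_apply_zero (ε : GnoSign L) (hz : ε.2.1 = true) (hF : ε.2.2 = fun _ => true) (u : ℝ × ℝ) :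
    (fun y : GnoFibreB L => trGnoDeficit uJ z₁ (sectorChar z₁) (hubAt (gnoFibreTrEquiv (u, gnoScaleTr u y)).1 1) ε (gnoFibreTrEquiv (u, gnoScaleTr u y)).2) 0 = 0 := by
  simp only [gnoFibreTrEquiv_gnoScaleTr_zero]
  exact trGnoDeficit_gnoBaseTr_eq_zero ε hz hF u

/-- ★ **THE 001 BASE IS CRITICAL**: `D_y (F₁∘Ψ(u,·))(0) = 0` — the deficit is `≥ 0` (✓`trGnoDeficit_nonneg`) and `= 0` at the base, so the origin of the fibre is a
minimum (✓`IsLocalMin.fderiv_eq_zero`). [folklore] -/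
theorem fderiv_trFibre_rescaled_base_eq_zero (ε : GnoSign L) (hz : ε.2.1 = true) (hF : ε.2.2 = fun _ => true) (u : ℝ × ℝ) :
    fderiv ℝ (fun y : GnoFibreB L => trGnoDeficit uJ z₁ (sectorChar z₁) (hubAt (gnoFibreTrEquiv (u, gnoScaleTr u y)).1 1) ε (gnoFibreTrEquiv (u, gnoScaleTr u y)).2) 0 = 0 := by
  refine IsLocalMin.fderiv_eq_zero (Filter.Eventually.of_forall fun y => ?_)
  rw [trFibre_rescaled_base_apply_zero ε hz hF u]
  exact trGnoDeficit_nonneg _ _ _ _ _ _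

end Summit.QuantumFields.YangMills.Theorems.SwapVirialDeficit.BlowUpRing

end
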